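import Mathlib
import Literature.Probability.Percolation.Percolation
import Literature.Probability.Percolation.RSW
import Literature.Probability.Percolation.IkhlefPonsaingFirstPassage
import Literature.Combinatorics.Enumerative.SymplecticCharacterVSASM
import HarnessLib

/-!
# Ikhlef–Ponsaing's first-passage probability: the base case `L = 1` and the finite-volume reduction

Topic `Literature/Probability/Percolation`. Companion (proof) file of
`IkhlefPonsaingFirstPassage.lean`, which states Ikhlef–Ponsaing, *Finite-size left-passage
probability in percolation*, J. Stat. Phys. 149 (2012) 10–36 (arXiv:1202.5476), Proposition 4.7,
read through the percolation dictionary as the named fact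
`Literature.Probability.Percolation.IkhlefPonsaingFirstPassage`: for bond percolation on `ℤ²` at
`p = 1/2`, a site `b` of level `b₀ + b₁ = 2m` is joined inside the diagonal strip
`0 ≤ x₀ + x₁ ≤ 2m + 1` to the wall `x₀ + x₁ = 0` with probability `A_V(2m+1) A_V(2m+3) / N_8(2m+2)²`.

The published proof (IP12 §3–§4) runs: (i) the infinite-strip probability is a bilinear form
`⟨Ψ|ρ|Ψ⟩/⟨Ψ|Ψ⟩` in the Perron vector `Ψ` of the stochastic double-row transfer matrix on link
patterns (§3.1, Def. 4.1); (ii) `Ψ` is the homogeneous specialisation of the polynomial solution of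
the `q`KZ system (§3.3–3.5, after Di Francesco 2005 and de Gier–Pyatov 2007); (iii) the sum rule
`Z_L = χ_L` (Prop. 3.4) and the passage formula `P_b^{(L)} = χ_{L-1} χ_{L+1} / χ_L²` (Props. 4.1, 4.3,
4.5: symmetry, recursion in the spectral parameters, degree counting, and the initialisation
"`P_b^{(1)}` must trivially be `1`"); (iv) the homogeneous symplectic-character evaluations
`χ_{2m}(1,…,1) = 3^{m(m-1)} A_V(2m+1)`, `χ_{2m-1}(1,…,1) = 3^{(m-1)²} N_8(2m)` (Di Francesco 2007).

This file lands the two ends of that chain that are elementary in the tree's vocabulary: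

* `ikhlefPonsaingFirstPassage_zero` — **the initialisation `L = 1` (`m = 0`)** of the recursion of
  Prop. 4.5 / Prop. 4.7: the site `b` lies on the wall, the event is sure, and the three products are
  `1`; this is literally the `m = 0` instance of the named fact.
* the **finite-volume reduction** behind step (i): `openConnIn_iUnion_of_monotone` (with
  `openConnIn_mono` of `RSW.lean`) (an open path is finite, so `{x ↔ y in ⋃ₙ Sₙ} = ⋃ₙ {x ↔ y in Sₙ}`
  for a monotone exhaustion) and `tendsto_measure_openConnIn_iUnion` /
  `tendsto_measure_wallEvent_iUnion` (continuity from below): the infinite-strip passage probability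
  is the limit of the passage probabilities of the truncated strips `|x₀ - x₁| ≤ N`, each of which is
  a finite sum over edge configurations (the transfer-matrix products of IP12 §3.1).

* `ikhlefPonsaingFirstPassage_iff_character_form` — with step (iv) PROVED in
  `Literature/Combinatorics/Enumerative/SymplecticCharacterVSASM.lean` (`ipSpDim_ratio_real`:
  `χ_{2m}(1) χ_{2m+2}(1) / χ_{2m+1}(1)² = A_V(2m+1) A_V(2m+3) / N_8(2m+2)²` for the Weyl-dimension
  rendering `ipSpDim L` of `χ_L(1,…,1)`), the named fact is EQUIVALENT to its pre-evaluation form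
  `P_{1/2}(b ↔ wall in strip) = χ_{2m}(1) χ_{2m+2}(1) / χ_{2m+1}(1)²`, i.e. to IP12 (P1form) = Prop. 4.5
  at the homogeneous point read through the dictionary (i).

Steps (i)–(iii) (the dictionary and the integrable `q`KZ programme) are carried out DOWNSTREAM of
this file — it is imported by `DiagonalStripLumping.lean` and `DiagonalStripStationary.lean`, the start
of that chain — so the discharge cannot live here or in `IkhlefPonsaingFirstPassage.lean` without an
import cycle. The named fact IS discharged (IP12 Prop. 4.7 for every `m`): the binder-free
`theorem IkhlefPonsaingFirstPassage_holds : IkhlefPonsaingFirstPassage` is proved in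
`Literature/Probability/Percolation/IkhlefPonsaingFirstPassageVertex.lean` (IP12 §3–§4, the polynomial
boundary-`q`KZ solution being supplied through the Hagendorf–Liénardy spin-chain vector,
arXiv:2008.03220 §3), on top of `IkhlefPonsaingFirstPassageAssembly.lean`
(`ikhlefPonsaingFirstPassage_of_polynomialSolution`) and `DiagonalStripHomogeneousPoint.lean`
(`ikhlefPonsaingFirstPassage_of_bounds`), which in turn rest on the character form proved below.

## References

* Y. Ikhlef, A. K. Ponsaing, J. Stat. Phys. 149 (2012) 10–36, arXiv:1202.5476, §3.1, Def. 4.1,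
  Props. 4.5, 4.7. [IkhlefPonsaing2012]
* G. Grimmett, *Percolation*, 2nd ed. (1999), §1.3 (events `{x ↔ y in S}`). [Grimmett1999]
-/

namespace Literature.Probability.Percolation

open _root_.MeasureTheory Filter
open scoped BigOperators Topology
open Literature.Probability.LatticeModels

/-! ### Finite-volume reduction of `{x ↔ y in S}` -/

section FiniteVolume

variable {V : Type*}

/-- Along a walk of the graph induced on a monotone union `⋃ₙ Sₙ`, some `S_N` (and every later
`Sₙ`) already contains the walk: its endpoints are joined inside `Sₙ`. [folklore] -/
private theorem reachable_induce_of_walk_iUnion {S : ℕ → Set V} (hS : Monotone S)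
    (G : SimpleGraph V) {u v : ↥(⋃ n, S n)} (p : (G.induce (⋃ n, S n)).Walk u v) :
    ∃ N, ∀ n, N ≤ n → ∃ (hu : (u : V) ∈ S n) (hv : (v : V) ∈ S n),
      (G.induce (S n)).Reachable ⟨u, hu⟩ ⟨v, hv⟩ := by
  induction p with
  | nil =>
    rename_i u
    obtain ⟨N, hN⟩ := Set.mem_iUnion.1 u.2
    exact ⟨N, fun n hn => ⟨hS hn hN, hS hn hN, SimpleGraph.Reachable.refl _⟩⟩
  | cons hadj p ih =>
    rename_i u w v
    obtain ⟨N₁, h₁⟩ := ih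
    obtain ⟨N₂, hN₂⟩ := Set.mem_iUnion.1 u.2
    refine ⟨max N₁ N₂, fun n hn => ?_⟩
    obtain ⟨hw, hv, hr⟩ := h₁ n (le_of_max_le_left hn)
    have hu : (u : V) ∈ S n := hS (le_of_max_le_right hn) hN₂
    refine ⟨hu, hv, ?_⟩
    have hadj' : (G.induce (S n)).Adj ⟨u, hu⟩ ⟨w, hw⟩ := by
      rw [SimpleGraph.induce_adj] at hadj ⊢
      exact hadj
    exact hadj'.reachable.trans hr

/-- **Finite-volume exhaustion of `{x ↔ y in S}`.** For a monotone sequence of vertex sets,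
`{x ↔ y in ⋃ₙ Sₙ} = ⋃ₙ {x ↔ y in Sₙ}`: an open path is finite, hence lies in one `Sₙ`.
[folklore] -/
theorem openConnIn_iUnion_of_monotone {S : ℕ → Set V} (hS : Monotone S) (x y : V) :
    openConnIn (⋃ n, S n) x y = ⋃ n, openConnIn (S n) x y := by
  ext ω
  refine ⟨?_, fun h => ?_⟩
  · rintro ⟨hx, hy, ⟨p⟩⟩
    obtain ⟨N, hN⟩ := reachable_induce_of_walk_iUnion hS (openGraph ω) p
    obtain ⟨hx', hy', hr⟩ := hN N le_rfl
    exact Set.mem_iUnion.2 ⟨N, hx', hy', hr⟩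
  · obtain ⟨n, hn⟩ := Set.mem_iUnion.1 h
    exact openConnIn_mono (Set.subset_iUnion S n) x y hn

/-- `{x ↔ y in Sₙ}` is a monotone sequence of events when `Sₙ` is. [folklore] -/
theorem monotone_openConnIn {S : ℕ → Set V} (hS : Monotone S) (x y : V) :
    Monotone fun n => openConnIn (S n) x y :=
  fun _ _ hmn => openConnIn_mono (hS hmn) x y

/-- **Continuity from below for `{x ↔ y in S}`**: under any measure on bond configurations,
`μ {x ↔ y in Sₙ} → μ {x ↔ y in ⋃ₙ Sₙ}` for a monotone exhaustion (no measurability needed).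
[folklore] -/
theorem tendsto_measure_openConnIn_iUnion (μ : Measure (BondConfig V)) {S : ℕ → Set V}
    (hS : Monotone S) (x y : V) :
    Tendsto (fun n => μ (openConnIn (S n) x y)) atTop (𝓝 (μ (openConnIn (⋃ n, S n) x y))) := by
  rw [openConnIn_iUnion_of_monotone hS]
  exact tendsto_measure_iUnion_atTop (monotone_openConnIn hS x y)

/-- The event "`x` is joined inside `S` to some vertex satisfying `W`" (e.g. a wall) exhausts
along a monotone sequence `Sₙ`: `{∃ w, W w ∧ x ↔ w in ⋃ₙ Sₙ} = ⋃ₙ {∃ w, W w ∧ x ↔ w in Sₙ}`.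
[folklore] -/
theorem wallEvent_iUnion_of_monotone {S : ℕ → Set V} (hS : Monotone S) (W : V → Prop) (x : V) :
    {ω : BondConfig V | ∃ w, W w ∧ ω ∈ openConnIn (⋃ n, S n) x w} =
      ⋃ n, {ω : BondConfig V | ∃ w, W w ∧ ω ∈ openConnIn (S n) x w} := by
  ext ω
  simp only [Set.mem_setOf_eq, Set.mem_iUnion, openConnIn_iUnion_of_monotone hS]
  exact ⟨fun ⟨w, hw, n, hn⟩ => ⟨n, w, hw, hn⟩, fun ⟨n, w, hw, hn⟩ => ⟨w, hw, n, hn⟩⟩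

/-- **Continuity from below for wall events**: `μ {∃ w, W w ∧ x ↔ w in Sₙ}` converges to
`μ {∃ w, W w ∧ x ↔ w in ⋃ₙ Sₙ}` along a monotone exhaustion. [folklore] -/
theorem tendsto_measure_wallEvent_iUnion (μ : Measure (BondConfig V)) {S : ℕ → Set V}
    (hS : Monotone S) (W : V → Prop) (x : V) :
    Tendsto (fun n => μ {ω : BondConfig V | ∃ w, W w ∧ ω ∈ openConnIn (S n) x w}) atTop
      (𝓝 (μ {ω : BondConfig V | ∃ w, W w ∧ ω ∈ openConnIn (⋃ n, S n) x w})) := by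
  rw [wallEvent_iUnion_of_monotone hS]
  refine tendsto_measure_iUnion_atTop fun m n hmn ω => ?_
  rintro ⟨w, hw, hω⟩
  exact ⟨w, hw, openConnIn_mono (hS hmn) x w hω⟩

/-- The same in terms of real-valued probabilities (`Measure.real`), for a finite measure. [folklore] -/
theorem tendsto_measureReal_wallEvent_iUnion (μ : Measure (BondConfig V)) [IsFiniteMeasure μ]
    {S : ℕ → Set V} (hS : Monotone S) (W : V → Prop) (x : V) :
    Tendsto (fun n => μ.real {ω : BondConfig V | ∃ w, W w ∧ ω ∈ openConnIn (S n) x w}) atTop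
      (𝓝 (μ.real {ω : BondConfig V | ∃ w, W w ∧ ω ∈ openConnIn (⋃ n, S n) x w})) := by
  simp only [measureReal_def]
  exact (ENNReal.tendsto_toReal (measure_ne_top μ _)).comp
    (tendsto_measure_wallEvent_iUnion μ hS W x)

end FiniteVolume

/-! ### The diagonal strip and its truncations -/

section Strip

/-- The diagonal strip `0 ≤ x₀ + x₁ ≤ 2m+1` is the monotone union of its truncations
`|x₀ - x₁| ≤ N` (finite boxes of the rotated lattice). [cite: IkhlefPonsaing2012, §2.2, §3.1] -/
theorem ipStrip_eq_iUnion (m : ℕ) :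
    {x : Site 2 | 0 ≤ x 0 + x 1 ∧ x 0 + x 1 ≤ ((2 * m + 1 : ℕ) : ℤ)} =
      ⋃ N : ℕ, ({x : Site 2 | 0 ≤ x 0 + x 1 ∧ x 0 + x 1 ≤ ((2 * m + 1 : ℕ) : ℤ)} ∩
        {x : Site 2 | |x 0 - x 1| ≤ (N : ℤ)}) := by
  ext x
  simp only [Set.mem_setOf_eq, Set.mem_iUnion, Set.mem_inter_iff]
  refine ⟨fun h => ⟨(|x 0 - x 1|).toNat, h, ?_⟩, fun ⟨_, h, _⟩ => h⟩
  rw [Int.toNat_of_nonneg (abs_nonneg _)]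

/-- The truncations `|x₀ - x₁| ≤ N` of the strip increase with `N`. [folklore] -/
theorem monotone_ipStripBox (m : ℕ) :
    Monotone fun N : ℕ => ({x : Site 2 | 0 ≤ x 0 + x 1 ∧ x 0 + x 1 ≤ ((2 * m + 1 : ℕ) : ℤ)} ∩
        {x : Site 2 | |x 0 - x 1| ≤ (N : ℤ)}) := by
  intro M N hMN x
  rintro ⟨h, hx⟩
  have hx' : |x 0 - x 1| ≤ (M : ℤ) := hx
  exact ⟨h, show |x 0 - x 1| ≤ (N : ℤ) from hx'.trans (by exact_mod_cast hMN)⟩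

/-- Each truncated strip is finite (it lies in a bounded box of `ℤ²`). [folklore] -/
theorem finite_ipStripBox (m N : ℕ) :
    ({x : Site 2 | 0 ≤ x 0 + x 1 ∧ x 0 + x 1 ≤ ((2 * m + 1 : ℕ) : ℤ)} ∩
        {x : Site 2 | |x 0 - x 1| ≤ (N : ℤ)}).Finite := by
  have hB : (Set.pi Set.univ fun _ : Fin 2 =>
      Set.Icc (-(N : ℤ) - (2 * m + 1 : ℕ)) ((N : ℤ) + (2 * m + 1 : ℕ))).Finite :=
    Set.Finite.pi fun _ => Set.finite_Icc _ _
  refine hB.subset ?_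
  rintro x ⟨⟨h0, h1⟩, hN⟩
  have hN' : |x 0 - x 1| ≤ (N : ℤ) := hN
  rw [abs_le] at hN'
  simp only [Set.mem_pi, Set.mem_univ, Set.mem_Icc, forall_true_left, Fin.forall_fin_two]
  push_cast at h1 ⊢
  omega

/-- **Finite-volume reduction of the Ikhlef–Ponsaing passage probability** (the first step of
IP12 §3.1: the infinite strip as a limit of finite pieces): the probability that `b` is joined to
the wall inside the infinite strip is the limit, as `N → ∞`, of the probabilities that it is joined
to the wall inside the truncated strips `|x₀ - x₁| ≤ N` — finite sums over the edge configurations of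
finite boxes. [cite: IkhlefPonsaing2012, §3.1] -/
theorem tendsto_ipPassage_trunc (μ : Measure (BondConfig (Site 2))) [IsFiniteMeasure μ]
    (m : ℕ) (b : Site 2) :
    Tendsto (fun N : ℕ => μ.real {ω | ∃ w : Site 2, w 0 + w 1 = 0 ∧
        ω ∈ openConnIn ({x : Site 2 | 0 ≤ x 0 + x 1 ∧ x 0 + x 1 ≤ ((2 * m + 1 : ℕ) : ℤ)} ∩
          {x : Site 2 | |x 0 - x 1| ≤ (N : ℤ)}) b w}) atTop
      (𝓝 (μ.real {ω | ∃ w : Site 2, w 0 + w 1 = 0 ∧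
        ω ∈ openConnIn {x : Site 2 | 0 ≤ x 0 + x 1 ∧ x 0 + x 1 ≤ ((2 * m + 1 : ℕ) : ℤ)} b w})) := by
  have h := tendsto_measureReal_wallEvent_iUnion μ (monotone_ipStripBox m)
    (fun w : Site 2 => w 0 + w 1 = 0) b
  rwa [← ipStrip_eq_iUnion m] at h

end Strip

/-! ### The base case `L = 1` -/

section BaseCase

/-- **Initialisation `L = 1` of Ikhlef–Ponsaing's recursion** ("`P_b^{(1)}` must trivially be `1`",
proof of Prop. 4.5; with `χ₀ = χ₁ = χ₂ = 1`, i.e. `A_V(1) = A_V(3) = N_8(2) = 1`, this is the case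
`m = 0` of Prop. 4.7 and literally the `m = 0` instance of the named fact
`IkhlefPonsaingFirstPassage`): a site `b` on the wall `b₀ + b₁ = 0` is joined to the wall inside
the strip `0 ≤ x₀ + x₁ ≤ 1` surely, and the three products evaluate to `1`.
[cite: IkhlefPonsaing2012, Prop. 4.5 (proof, case L = 1) and Prop. 4.7] -/
theorem ikhlefPonsaingFirstPassage_zero (b : Site 2) (hb : b 0 + b 1 = 2 * (0 : ℕ)) :
    (bondPercolation (zdGraph 2) half).real
        {ω | ∃ w : Site 2, w 0 + w 1 = 0 ∧
          ω ∈ openConnIn {x : Site 2 | 0 ≤ x 0 + x 1 ∧ x 0 + x 1 ≤ ((2 * 0 + 1 : ℕ) : ℤ)} b w} =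
      (∏ i ∈ Finset.range 0,
          ((3 * i + 2 : ℕ) * (6 * i + 3).factorial * (2 * i + 1).factorial : ℝ) /
            ((4 * i + 2).factorial * (4 * i + 3).factorial : ℝ)) *
        (∏ i ∈ Finset.range (0 + 1),
          ((3 * i + 2 : ℕ) * (6 * i + 3).factorial * (2 * i + 1).factorial : ℝ) /
            ((4 * i + 2).factorial * (4 * i + 3).factorial : ℝ)) /
      (∏ i ∈ Finset.range (0 + 1),
          ((3 * i + 1 : ℕ) * (6 * i).factorial * (2 * i).factorial : ℝ) /
            ((4 * i).factorial * (4 * i + 1).factorial : ℝ)) ^ 2 := by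
  have hb0 : b 0 + b 1 = 0 := by simpa using hb
  have hmem : b ∈ {x : Site 2 | 0 ≤ x 0 + x 1 ∧ x 0 + x 1 ≤ ((2 * 0 + 1 : ℕ) : ℤ)} := by
    simp only [Set.mem_setOf_eq, hb0]
    norm_num
  have hev : {ω : BondConfig (Site 2) | ∃ w : Site 2, w 0 + w 1 = 0 ∧
      ω ∈ openConnIn {x : Site 2 | 0 ≤ x 0 + x 1 ∧ x 0 + x 1 ≤ ((2 * 0 + 1 : ℕ) : ℤ)} b w} =
        Set.univ := by
    refine Set.eq_univ_of_forall fun ω => ⟨b, hb0, hmem, hmem, SimpleGraph.Reachable.refl _⟩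
  rw [hev, probReal_univ]
  norm_num [Nat.factorial]

/-- The base case is an instance of the named fact: `IkhlefPonsaingFirstPassage` at `m = 0` is
exactly `ikhlefPonsaingFirstPassage_zero` (a consistency check of the statement's shape).
[cite: IkhlefPonsaing2012, Prop. 4.7] -/
theorem ikhlefPonsaingFirstPassage_of_pos
    (h : ∀ (m : ℕ) (b : Site 2), 0 < m → b 0 + b 1 = 2 * m →
      (bondPercolation (zdGraph 2) half).real
          {ω | ∃ w : Site 2, w 0 + w 1 = 0 ∧
            ω ∈ openConnIn {x : Site 2 | 0 ≤ x 0 + x 1 ∧ x 0 + x 1 ≤ ((2 * m + 1 : ℕ) : ℤ)} b w} =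
        (∏ i ∈ Finset.range m,
            ((3 * i + 2 : ℕ) * (6 * i + 3).factorial * (2 * i + 1).factorial : ℝ) /
              ((4 * i + 2).factorial * (4 * i + 3).factorial : ℝ)) *
          (∏ i ∈ Finset.range (m + 1),
            ((3 * i + 2 : ℕ) * (6 * i + 3).factorial * (2 * i + 1).factorial : ℝ) /
              ((4 * i + 2).factorial * (4 * i + 3).factorial : ℝ)) /
        (∏ i ∈ Finset.range (m + 1),
            ((3 * i + 1 : ℕ) * (6 * i).factorial * (2 * i).factorial : ℝ) /
              ((4 * i).factorial * (4 * i + 1).factorial : ℝ)) ^ 2) :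
    IkhlefPonsaingFirstPassage := by
  intro m b hb
  rcases Nat.eq_zero_or_pos m with rfl | hm
  · exact ikhlefPonsaingFirstPassage_zero b hb
  · exact h m b hm hb

end BaseCase

/-! ### The fact in character form (what remains after Di Francesco's evaluations) -/

section CharacterForm

open Literature.Combinatorics.Enumerative

/-- **Ikhlef–Ponsaing's Prop. 4.7 in character form.** By Di Francesco's evaluations
(`ipSpDim_ratio_real`), the named fact `IkhlefPonsaingFirstPassage` is equivalent to
`P_{1/2}(b ↔ wall in the strip 0 ≤ x₀+x₁ ≤ 2m+1) = χ_{2m}(1) χ_{2m+2}(1) / χ_{2m+1}(1)²` with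
`χ_L(1,…,1)` rendered as the Weyl dimension `ipSpDim L` — IP12's (P1form) (= Prop. 4.5,
`P_b^{(L)} = χ_{L-1} χ_{L+1} / χ_L²`) at the homogeneous point `z_i = 1`, read through the percolation
dictionary. This is precisely the part of the printed proof that is not yet in the tree.
[cite: IkhlefPonsaing2012, Props. 4.5, 4.7] -/
theorem ikhlefPonsaingFirstPassage_iff_character_form :
    IkhlefPonsaingFirstPassage ↔ ∀ (m : ℕ) (b : Site 2), b 0 + b 1 = 2 * m →
      (bondPercolation (zdGraph 2) half).real
          {ω | ∃ w : Site 2, w 0 + w 1 = 0 ∧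
            ω ∈ openConnIn {x : Site 2 | 0 ≤ x 0 + x 1 ∧ x 0 + x 1 ≤ ((2 * m + 1 : ℕ) : ℤ)} b w} =
        ((ipSpDim (2 * m) * ipSpDim (2 * m + 2) / ipSpDim (2 * m + 1) ^ 2 : ℚ) : ℝ) := by
  unfold IkhlefPonsaingFirstPassage
  refine forall₃_congr fun m b _ => ?_
  rw [ipSpDim_ratio_real]

end CharacterForm

end Literature.Probability.Percolation
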